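import Summits.CriticalPhenomena.Ising3DConformalLimit.Theses.MonotoneBlocking
import Summits.CriticalPhenomena.Ising3DConformalLimit.Theses.MirrorHoelderCompactness
import Literature.Probability.LatticeModels.CriticalBlockMoments
import Literature.Probability.LatticeModels.CriticalAxisRatioRegularity
import Summits.CriticalPhenomena.Ising3DConformalLimit.Theorems.HyperoctahedralRPExistsScaleCovariantLimitNonSeparableModulusOfUniformRegularity
import Summits.CriticalPhenomena.Ising3DConformalLimit.Theorems.HyperoctahedralRPExistsScaleCovariantLimitCompactnessItemMapsDoubling
import HarnessLib

/-!
# Axial pincer: `NonSeparableModulus ↔ TwoPointDoubling` (crux stmt-CriticalPhenomena-6152 ≡ item 6150)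

Crux-ideate evidence of seat `planner-cruxidea-stmt-CriticalPhenomena-6152-2-0` (round 1, ideator 2),
routes `MonotoneBlocking` / `MirrorHoelderCompactness`, sub-problem `CriticalPhenomena/Ising3DConformalLimit`.
NO `sorry`, no named-fact hypothesis, no new axiom (`#print axioms` = propext, Classical.choice, Quot.sound).

MAIN THEOREMS
* `twoPointDoubling_of_nonSeparableModulus : MonotoneBlocking.NonSeparableModulus → MirrorHoelderCompactness.TwoPointDoubling`
  (NEW direction, item 6152 ⟹ item 6150);
* `nonSeparableModulus_iff_twoPointDoubling : MonotoneBlocking.NonSeparableModulus ↔ MirrorHoelderCompactness.TwoPointDoubling`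
  (with the landed converse 6150 ⟹ 4658 ⟹ 6152: `ItemMaps.uniformRegularity_of_doubling`,
  `TwoHierarchies.stub_nonSeparableModulus_of_uniformRegularity`); `mirror_…` = the MHC copy.

MECHANISM (the "axial pincer"). Write `g k = ⟨σ₀σ_{k e₀}⟩_{β_c}`, `F_n^δ = ρ★(δ)ⁿ⟨∏σ_{⌊x_i/δ⌋}⟩`,
`ρ★(δ) = g(⌊δ⁻¹⌋)^{-1/2}`. Take `n = 4`, the collinear configuration `x₀ = (0, ½, 1, 2)·e₀` — its point
`x₀ 1 = ½e₀` lies strictly between `x₀ 0` and `x₀ 2`, so it is NOT `m`-separable by ANY vector `u`, for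
any `m > 0` (`x0_caged`; a fortiori not by the nine mirror normals) — mesh `δ = 1/(2n)` (lattice sites
`0, n, 2n, 4n` on the axis) and the retreated point `y = ((n−J)/(2n))·e₀`, `J = ⌊n/p⌋ + 1`.
* Aizenman–Duminil-Copin 2021 (3.12), `|U₄| ≤ 2⟨σσ⟩⟨σσ⟩` (tree `abs_criticalUrsellFour_le_two_mul_pair0k`),
  with axis monotonicity: `F₄^δ(x₀) ≤ 4 g(n)/g(2n) + 1` (`F_x0_le`) and
  `F₄^δ(update x₀ 1 y) ≥ g(n−J)/g(2n) − 1` (`F_update_ge`).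
* Reflection-positivity log-convexity (tree `criticalTwoPoint_axis_ratio_mono`: `r_k = g(k+2)/g(k+1)`
  nondecreasing) propagates a doubling defect BACKWARDS along the axis: `g(2n) ≥ r_{n−1}ⁿ g(n)` and
  `g(n) ≤ r_{n−1}^J g(n−J)`, so `g(2n) < κ g(n)` with `κ ≤ 8^{-p}`, `pJ ≥ n` forces `8 g(n) ≤ g(n−J)`
  (`eight_mul_le_of_ratio_lt`).
* If doubling failed, pick the defect scale `n` beyond the NS thresholds (`δ < δ₀`, `J/(2n) < η`): NS at
  `ε = 1` gives `g(n−J)/g(2n) − 1 < 4g(n)/g(2n) + 2`, i.e. `g(n−J) < 4 g(n) + 3 g(2n) ≤ 7 g(n)` — against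
  `8 g(n) ≤ g(n−J)`.

CONSEQUENCE FOR THE CRUX CHAIN. NS is EXACTLY all-scale axial doubling (item 6150 ⟺ 4658 ⟺ 5955 by the
landed item maps): it has no content independent of the sibling rank-2 crux of `MirrorHoelderCompactness`,
and in `MonotoneBlocking` it is implied by BM₂ (landed). Every line / idea for NS is a line for 6150 and
conversely; the strategist census' open question ("NS may be logically weaker than 6150") is settled: no.

References: M. Aizenman, H. Duminil-Copin, Ann. of Math. 194 (2021) = arXiv:1912.07973, eq. (3.12),
Prop. 5.3/5.9 (log-convexity), Remark 5.10 (doubling open) [AizenmanDuminilCopinAnnals2021];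
A. Messager, S. Miracle-Solé, J. Stat. Phys. 17 (1977) [MessagerMiracleSoleJSP1977]. [folklore] otherwise.
-/

noncomputable section

namespace Summit.CriticalPhenomena.Ising3DConformalLimit.Cruxes.NonSeparableModulus.AxialPincer

open Literature.Probability.LatticeModels

/-- The critical axis profile `g k = ⟨σ₀σ_{k e₀}⟩_{β_c(3)}`. -/
def g (k : ℕ) : ℝ := criticalTwoPoint 3 (Pi.single 0 (k : ℤ))

theorem g_pos (k : ℕ) : 0 < g k := by
  unfold g
  by_cases hx : (Pi.single 0 (k : ℤ) : Site 3) = 0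
  · rw [hx, criticalTwoPoint_zero']; exact one_pos
  · obtain ⟨c, C, hc, hb⟩ := criticalTwoPoint_bounds_holds (d := 3) le_rfl
    exact lt_of_lt_of_le (mul_pos hc (Real.rpow_pos_of_pos (norm_pos_iff.2 hx) _)) (hb _ hx).1

theorem g_le_one (k : ℕ) : g k ≤ 1 := criticalTwoPoint_le_one' _

/-- The axis ratios `r k = g (k+2) / g (k+1)` (nondecreasing by reflection positivity). -/
def r (k : ℕ) : ℝ := g (k + 2) / g (k + 1)

theorem r_mono : Monotone r := criticalTwoPoint_axis_ratio_mono 0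

theorem r_le_one (k : ℕ) : r k ≤ 1 := criticalTwoPoint_axis_ratio_le_one 0 k

theorem r_pos (k : ℕ) : 0 < r k := div_pos (g_pos _) (g_pos _)

theorem g_step (k : ℕ) : g (k + 2) = r k * g (k + 1) := by
  unfold r
  field_simp [(g_pos (k + 1)).ne']

/-- MMS/log-convexity monotonicity along the axis from the first step on. -/
theorem g_succ_le (k : ℕ) : g (k + 2) ≤ g (k + 1) := criticalTwoPoint_axis_succ_le 0 k

theorem g_anti {a b : ℕ} (ha : 1 ≤ a) (hab : a ≤ b) : g b ≤ g a := by
  obtain ⟨m, rfl⟩ := Nat.exists_eq_add_of_le hab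
  induction m with
  | zero => simp
  | succ m ih =>
    have h1 : g (a + m + 1) ≤ g (a + m) := by
      obtain ⟨a', rfl⟩ := Nat.exists_eq_add_of_le ha
      have := g_succ_le (a' + m)
      rw [show 1 + a' + m + 1 = a' + m + 2 by omega, show 1 + a' + m = a' + m + 1 by omega]
      exact this
    rw [show a + (m + 1) = a + m + 1 by omega]
    exact h1.trans (ih (Nat.le_add_right a m))

/-- Forward propagation: `g (n + m) ≥ (r (n-1))^m * g n` for `n ≥ 1`. -/
theorem g_forward {n : ℕ} (hn : 1 ≤ n) (m : ℕ) : r (n - 1) ^ m * g n ≤ g (n + m) := by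
  induction m with
  | zero => simp
  | succ m ih =>
    have hstep : g (n + m + 1) = r (n + m - 1) * g (n + m) := by
      have := g_step (n + m - 1)
      rw [show n + m - 1 + 2 = n + m + 1 by omega, show n + m - 1 + 1 = n + m by omega] at this
      exact this
    have hr : r (n - 1) ≤ r (n + m - 1) := r_mono (by omega)
    rw [show n + (m + 1) = n + m + 1 by omega, hstep, pow_succ]
    calc r (n - 1) ^ m * r (n - 1) * g n = r (n - 1) * (r (n - 1) ^ m * g n) := by ring
      _ ≤ r (n + m - 1) * g (n + m) :=
          mul_le_mul hr ih (mul_nonneg (pow_nonneg (r_pos _).le m) (g_pos _).le) (r_pos _).le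

/-- Backward propagation: `g (a + m) ≤ (r (n-1))^m * g a` whenever `1 ≤ a` and `a + m ≤ n`. -/
theorem g_backward {n a : ℕ} (ha : 1 ≤ a) (m : ℕ) (ham : a + m ≤ n) :
    g (a + m) ≤ r (n - 1) ^ m * g a := by
  induction m with
  | zero => simp
  | succ m ih =>
    have ih' := ih (by omega)
    have hstep : g (a + m + 1) = r (a + m - 1) * g (a + m) := by
      have := g_step (a + m - 1)
      rw [show a + m - 1 + 2 = a + m + 1 by omega, show a + m - 1 + 1 = a + m by omega] at this
      exact this
    have hr : r (a + m - 1) ≤ r (n - 1) := r_mono (by omega)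
    rw [show a + (m + 1) = a + m + 1 by omega, hstep, pow_succ]
    calc r (a + m - 1) * g (a + m) ≤ r (n - 1) * (r (n - 1) ^ m * g a) :=
          mul_le_mul hr ih' (g_pos _).le (r_pos _).le
      _ = r (n - 1) ^ m * r (n - 1) * g a := by ring

/-- The pincer's scalar core: if `g (2n) < κ g n` with `κ ≤ (1/8)^p` and `p * J ≥ n`, `1 ≤ n - J`,
then `8 g n ≤ g (n - J)`. -/
theorem eight_mul_le_of_ratio_lt {n J p : ℕ} {κ : ℝ} (hn : 1 ≤ n) (hJ : J + 1 ≤ n)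
    (hpJ : n ≤ p * J) (hκ : κ ≤ (1 / 8 : ℝ) ^ p) (hlt : g (2 * n) < κ * g n) :
    8 * g n ≤ g (n - J) := by
  set ρ := r (n - 1) with hρ
  have hρpos : 0 < ρ := r_pos _
  have hρ1 : ρ ≤ 1 := r_le_one _
  -- forward: ρ^n g n ≤ g (2n)
  have hf : ρ ^ n * g n ≤ g (2 * n) := by
    have := g_forward hn n
    rwa [show n + n = 2 * n by ring] at this
  have hρn : ρ ^ n < κ := by
    have h := lt_of_le_of_lt hf hlt
    exact lt_of_mul_lt_mul_right h (g_pos n).le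
  -- hence ρ^J ≤ 1/8
  have hρJ : ρ ^ J ≤ 1 / 8 := by
    by_contra hcon
    push Not at hcon
    have h1 : (1 / 8 : ℝ) ^ p < (ρ ^ J) ^ p := by
      have hp : p ≠ 0 := by
        rintro rfl
        simp at hpJ
        omega
      exact pow_lt_pow_left₀ hcon (by norm_num) hp
    have h2 : (ρ ^ J) ^ p ≤ ρ ^ n := by
      rw [← pow_mul]
      exact pow_le_pow_of_le_one hρpos.le hρ1 (by rw [mul_comm]; exact hpJ)
    linarith
  -- backward: g n ≤ ρ^J g (n - J)
  have hb : g n ≤ ρ ^ J * g (n - J) := by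
    have := g_backward (n := n) (a := n - J) (by omega) J (by omega)
    rwa [show n - J + J = n by omega] at this
  calc 8 * g n ≤ 8 * (ρ ^ J * g (n - J)) := by linarith
    _ ≤ 8 * ((1 / 8) * g (n - J)) := by
        have := mul_le_mul_of_nonneg_right hρJ (g_pos (n - J)).le
        linarith
    _ = g (n - J) := by ring


/-! ### Four-point bounds at the two collinear lattice configurations -/

/-- `P k = k e₀ ∈ ℤ³`. -/
def P (k : ℕ) : Site 3 := Pi.single 0 (k : ℤ)

theorem P_sub {a b : ℕ} (h : a ≤ b) : P b - P a = Pi.single 0 ((b - a : ℕ) : ℤ) := by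
  unfold P
  rw [← Pi.single_sub, Nat.cast_sub h]

theorem C2_eq {a b : ℕ} (h : a ≤ b) : criticalCorr 3 2 ![P a, P b] = g (b - a) := by
  rw [criticalCorr_two_pair, P_sub h]
  rfl

theorem C2_eq' {a b : ℕ} (h : b ≤ a) : criticalCorr 3 2 ![P a, P b] = g (a - b) := by
  rw [criticalCorr_two_pair_comm, C2_eq h]

/-- Upper bound at the caged midpoint configuration `(0, n, 2n, 4n)·e₀`:
`⟨σσσσ⟩ ≤ 4 g(n) g(2n) + g(2n)²` (Aizenman–Duminil-Copin (3.12) + axis monotonicity). -/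
theorem four_point_mid_le {n : ℕ} (hn : 1 ≤ n) :
    criticalCorr 3 4 ![P 0, P n, P (2 * n), P (4 * n)] ≤ 4 * g n * g (2 * n) + g (2 * n) ^ 2 := by
  have h := abs_criticalUrsellFour_le_two_mul_pair01 (d := 3) le_rfl (P 0) (P n) (P (2 * n)) (P (4 * n))
  have hab : criticalCorr 3 2 ![P 0, P n] = g n := by rw [C2_eq (Nat.zero_le _)]; simp
  have hce : criticalCorr 3 2 ![P (2 * n), P (4 * n)] = g (2 * n) := by
    rw [C2_eq (by omega)]; congr 1; omega
  have hac : criticalCorr 3 2 ![P 0, P (2 * n)] = g (2 * n) := by rw [C2_eq (Nat.zero_le _)]; simp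
  have hbe : criticalCorr 3 2 ![P n, P (4 * n)] = g (3 * n) := by
    rw [C2_eq (by omega)]; congr 1; omega
  have hae : criticalCorr 3 2 ![P 0, P (4 * n)] = g (4 * n) := by rw [C2_eq (Nat.zero_le _)]; simp
  have hbc : criticalCorr 3 2 ![P n, P (2 * n)] = g n := by
    rw [C2_eq (by omega)]; congr 1; omega
  rw [hab, hce, hac, hbe, hae, hbc] at h
  have h1 := (abs_le.1 h).2
  have h3 : g (3 * n) ≤ g (2 * n) := g_anti (by omega) (by omega)
  have h4 : g (4 * n) ≤ g (2 * n) := g_anti (by omega) (by omega)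
  have hg2 := (g_pos (2 * n)).le
  have hgn := (g_pos n).le
  nlinarith [mul_le_mul_of_nonneg_left h3 hg2, mul_le_mul_of_nonneg_left h4 hgn]

/-- Lower bound at the retreated configuration `(0, a, 2n, 4n)·e₀`, `a ≤ n`:
`⟨σσσσ⟩ ≥ g(a) g(2n) − g(2n)²` (Aizenman–Duminil-Copin (3.12) for the pairing `{0,2n}{a,4n}`,
Griffiths positivity, axis monotonicity). -/
theorem four_point_retreat_ge {n a : ℕ} (hn : 1 ≤ n) (ha : a ≤ n) :
    g a * g (2 * n) - g (2 * n) ^ 2 ≤ criticalCorr 3 4 ![P 0, P a, P (2 * n), P (4 * n)] := by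
  have h := abs_criticalUrsellFour_le_two_mul_pair02 (d := 3) le_rfl (P 0) (P a) (P (2 * n)) (P (4 * n))
  have hab : criticalCorr 3 2 ![P 0, P a] = g a := by rw [C2_eq (Nat.zero_le _)]; simp
  have hce : criticalCorr 3 2 ![P (2 * n), P (4 * n)] = g (2 * n) := by
    rw [C2_eq (by omega)]; congr 1; omega
  have hac : criticalCorr 3 2 ![P 0, P (2 * n)] = g (2 * n) := by rw [C2_eq (Nat.zero_le _)]; simp
  have hbe : criticalCorr 3 2 ![P a, P (4 * n)] = g (4 * n - a) := by rw [C2_eq (by omega)]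
  have hae : criticalCorr 3 2 ![P 0, P (4 * n)] = g (4 * n) := by rw [C2_eq (Nat.zero_le _)]; simp
  have hbc : criticalCorr 3 2 ![P a, P (2 * n)] = g (2 * n - a) := by rw [C2_eq (by omega)]
  rw [hab, hce, hac, hbe, hae, hbc] at h
  have h1 := (abs_le.1 h).1
  have h4 : g (4 * n - a) ≤ g (2 * n) := g_anti (by omega) (by omega)
  have hg2 := (g_pos (2 * n)).le
  have hprod : 0 ≤ g (4 * n) * g (2 * n - a) := mul_nonneg (g_pos _).le (g_pos _).le
  nlinarith [mul_le_mul_of_nonneg_left h4 hg2]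


/-! ### The collinear test configuration `(0, ½, 1, 2)·e₀` and its lattice shadows -/

/-- The unit vector `e₀ ∈ ℝ³`. -/
def e0 : EuclideanSpace ℝ (Fin 3) := EuclideanSpace.single 0 1

theorem e0_apply (k : Fin 3) : e0 k = if k = 0 then 1 else 0 := by
  simp [e0]

theorem norm_e0 : ‖e0‖ = 1 := by simp [e0]

theorem inner_smul_e0 (u : EuclideanSpace ℝ (Fin 3)) (c : ℝ) :
    inner ℝ u (c • e0) = c * inner ℝ u e0 := by
  rw [real_inner_smul_right]

theorem latticeApprox_smul_e0 (δ c : ℝ) : latticeApprox δ (c • e0) = Pi.single 0 ⌊c / δ⌋ := by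
  funext k
  rw [latticeApprox_apply]
  by_cases hk : k = 0
  · subst hk; simp [e0_apply]
  · simp [e0_apply, hk]

theorem latticeApprox_smul_e0_eq_P {n : ℕ} (c : ℝ) (k : ℕ) (hck : c * (2 * n : ℕ) = k) :
    latticeApprox ((2 * n : ℕ) : ℝ)⁻¹ (c • e0) = P k := by
  rw [latticeApprox_smul_e0, div_inv_eq_mul, hck, Int.floor_natCast]
  rfl

/-- The coefficients `(0, ½, 1, 2)`. -/
def coef : Fin 4 → ℝ := ![0, 1 / 2, 1, 2]

@[simp] theorem coef_zero : coef 0 = 0 := rfl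
@[simp] theorem coef_one : coef 1 = 1 / 2 := rfl
@[simp] theorem coef_two : coef 2 = 1 := rfl
@[simp] theorem coef_three : coef 3 = 2 := rfl

/-- The test configuration `x₀ = (0, ½e₀, e₀, 2e₀)`; its point `1` is the caged midpoint. -/
def x0 : Fin 4 → EuclideanSpace ℝ (Fin 3) := fun i => coef i • e0

theorem x0_apply_zero (i : Fin 4) : x0 i 0 = coef i := by
  simp [x0, e0_apply]

theorem x0_injective : Function.Injective x0 := by
  intro i j h
  have h' := congrArg (fun v : EuclideanSpace ℝ (Fin 3) => v 0) h
  simp only [x0_apply_zero] at h'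
  fin_cases i <;> fin_cases j <;> first | rfl | norm_num [coef] at h'

theorem x0_mem : x0 ∈ NonCoincident 3 4 := x0_injective

theorem inner_x0 (u : EuclideanSpace ℝ (Fin 3)) (j : Fin 4) :
    inner ℝ u (x0 j) = coef j * inner ℝ u e0 := by
  simp only [x0, inner_smul_e0]

/-- The midpoint `x₀ 1` is NOT `m`-separable for any `m > 0` — by any vector `u` whatsoever
(it lies strictly between `x₀ 0` and `x₀ 2` on a line). -/
theorem x0_caged {m : ℝ} (hm : 0 < m) (u : EuclideanSpace ℝ (Fin 3)) :
    ¬ ((∀ j : Fin 4, j ≠ 1 → inner ℝ u (x0 j) + m ≤ inner ℝ u (x0 1)) ∨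
       (∀ j : Fin 4, j ≠ 1 → inner ℝ u (x0 1) + m ≤ inner ℝ u (x0 j))) := by
  rintro (h | h)
  · have h0 := h 0 (by decide)
    have h2 := h 2 (by decide)
    simp only [inner_x0, coef_zero, coef_one, coef_two] at h0 h2
    linarith
  · have h0 := h 0 (by decide)
    have h2 := h 2 (by decide)
    simp only [inner_x0, coef_zero, coef_one, coef_two] at h0 h2
    linarith

/-- Lattice shadow of `x₀` at mesh `δ = 1/(2n)`: the sites `(0, n, 2n, 4n)·e₀`. -/
theorem latticeApprox_x0 (n : ℕ) :
    (fun i => latticeApprox ((2 * n : ℕ) : ℝ)⁻¹ (x0 i)) = ![P 0, P n, P (2 * n), P (4 * n)] := by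
  funext i
  fin_cases i
  · show latticeApprox _ (coef 0 • e0) = P 0
    exact latticeApprox_smul_e0_eq_P _ _ (by simp)
  · show latticeApprox _ (coef 1 • e0) = P n
    exact latticeApprox_smul_e0_eq_P _ _ (by rw [coef_one]; push_cast; ring)
  · show latticeApprox _ (coef 2 • e0) = P (2 * n)
    exact latticeApprox_smul_e0_eq_P _ _ (by rw [coef_two]; push_cast; ring)
  · show latticeApprox _ (coef 3 • e0) = P (4 * n)
    exact latticeApprox_smul_e0_eq_P _ _ (by rw [coef_three]; push_cast; ring)

/-- The lattice shadow of `update x₀ 1 y` for the retreated point `y = (a/(2n))·e₀`. -/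
theorem latticeApprox_update {n : ℕ} (a : ℕ) (hn : 1 ≤ n) :
    (fun i => latticeApprox ((2 * n : ℕ) : ℝ)⁻¹
      (Function.update x0 1 ((((a : ℕ) : ℝ) / ((2 * n : ℕ) : ℝ)) • e0) i)) =
      ![P 0, P a, P (2 * n), P (4 * n)] := by
  have hn' : ((2 * n : ℕ) : ℝ) ≠ 0 := by positivity
  funext i
  fin_cases i
  · show latticeApprox _ (Function.update x0 1 _ 0) = P 0
    rw [Function.update_of_ne (by decide)]
    exact latticeApprox_smul_e0_eq_P _ _ (by simp)
  · show latticeApprox _ (Function.update x0 1 _ 1) = P a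
    rw [Function.update_self]
    exact latticeApprox_smul_e0_eq_P _ _ (by field_simp)
  · show latticeApprox _ (Function.update x0 1 _ 2) = P (2 * n)
    rw [Function.update_of_ne (by decide)]
    exact latticeApprox_smul_e0_eq_P _ _ (by simp only [coef_two]; push_cast; ring)
  · show latticeApprox _ (Function.update x0 1 _ 3) = P (4 * n)
    rw [Function.update_of_ne (by decide)]
    exact latticeApprox_smul_e0_eq_P _ _ (by simp only [coef_three]; push_cast; ring)


/-! ### The two rescaled correlators at mesh `1/(2n)` -/

/-- The pinning `ρ★(δ) = ⟨σ₀σ_{⌊δ⁻¹⌋e₀}⟩^{-1/2}` of the crux (verbatim). -/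
def rhoStar : ℝ → ℝ := fun δ : ℝ => (criticalTwoPoint 3 (Pi.single 0 ⌊δ⁻¹⌋)) ^ (-(1/2:ℝ))

/-- The mesh `δ = 1/(2n)`. -/
def mesh (n : ℕ) : ℝ := ((2 * n : ℕ) : ℝ)⁻¹

/-- The retreated point `y = (a/(2n))·e₀`. -/
def yPt (n a : ℕ) : EuclideanSpace ℝ (Fin 3) := (((a : ℕ) : ℝ) / ((2 * n : ℕ) : ℝ)) • e0

theorem mesh_pos {n : ℕ} (hn : 1 ≤ n) : 0 < mesh n := by
  unfold mesh; positivity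

theorem rhoStar_mesh_pow_four (n : ℕ) : rhoStar (mesh n) ^ 4 = (g (2 * n) ^ 2)⁻¹ := by
  unfold rhoStar mesh
  rw [inv_inv, Int.floor_natCast]
  change ((g (2 * n)) ^ (-(1/2:ℝ))) ^ 4 = _
  rw [← Real.rpow_natCast, ← Real.rpow_mul (g_pos _).le,
    show (-(1/2:ℝ)) * ((4:ℕ):ℝ) = -2 by norm_num, Real.rpow_neg (g_pos _).le, Real.rpow_two]

/-- `F₄^δ(x₀) ≤ 4 g(n)/g(2n) + 1` at `δ = 1/(2n)`. -/
theorem F_x0_le {n : ℕ} (hn : 1 ≤ n) :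
    rescaledCorrelator (criticalCorr 3) rhoStar 4 (mesh n) x0 ≤ 4 * g n / g (2 * n) + 1 := by
  rw [rescaledCorrelator_apply, rhoStar_mesh_pow_four]
  change (g (2 * n) ^ 2)⁻¹ * criticalCorr 3 4 (fun i => latticeApprox ((2 * n : ℕ) : ℝ)⁻¹ (x0 i)) ≤ _
  rw [latticeApprox_x0 n]
  have hC := four_point_mid_le hn
  have hg2 := g_pos (2 * n)
  calc (g (2 * n) ^ 2)⁻¹ * criticalCorr 3 4 ![P 0, P n, P (2 * n), P (4 * n)]
      ≤ (g (2 * n) ^ 2)⁻¹ * (4 * g n * g (2 * n) + g (2 * n) ^ 2) :=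
        mul_le_mul_of_nonneg_left hC (by positivity)
    _ = 4 * g n / g (2 * n) + 1 := by field_simp

/-- `F₄^δ(update x₀ 1 y) ≥ g(a)/g(2n) − 1` at `δ = 1/(2n)`, `y = (a/(2n))e₀`, `a ≤ n`. -/
theorem F_update_ge {n a : ℕ} (hn : 1 ≤ n) (han : a ≤ n) :
    g a / g (2 * n) - 1 ≤
      rescaledCorrelator (criticalCorr 3) rhoStar 4 (mesh n) (Function.update x0 1 (yPt n a)) := by
  rw [rescaledCorrelator_apply, rhoStar_mesh_pow_four]
  change _ ≤ (g (2 * n) ^ 2)⁻¹ * criticalCorr 3 4 (fun i => latticeApprox ((2 * n : ℕ) : ℝ)⁻¹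
    (Function.update x0 1 ((((a : ℕ) : ℝ) / ((2 * n : ℕ) : ℝ)) • e0) i))
  rw [latticeApprox_update a hn]
  have hC := four_point_retreat_ge hn han
  have hg2 := g_pos (2 * n)
  calc g a / g (2 * n) - 1 = (g (2 * n) ^ 2)⁻¹ * (g a * g (2 * n) - g (2 * n) ^ 2) := by field_simp
    _ ≤ (g (2 * n) ^ 2)⁻¹ * criticalCorr 3 4 ![P 0, P a, P (2 * n), P (4 * n)] :=
        mul_le_mul_of_nonneg_left hC (by positivity)

/-! ### Main theorem -/

open Summit.CriticalPhenomena.Ising3DConformalLimit.Theses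

/-- **The axial pincer: `NonSeparableModulus → TwoPointDoubling`** (item 6152 ⟹ item 6150).
If doubling fails at scale `n` with defect `g(2n)/g(n) < κ`, reflection-positivity log-convexity
propagates the defect one notch backwards (`8 g(n) ≤ g(n − J)` for a retreat `J ≈ n/p`), and the
4-point zoom at the caged midpoint configuration `(0, ½, 1, 2)·e₀`, mesh `1/(2n)`, jumps by more
than `1` under the retreat `½ ↦ (n−J)/(2n)` — against NS with `ε = 1`. -/
theorem twoPointDoubling_of_nonSeparableModulus (hNS : MonotoneBlocking.NonSeparableModulus) :
    MirrorHoelderCompactness.TwoPointDoubling := by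
  by_contra hD
  -- (0) failure of doubling, in `g`-form
  have hD' : ∀ κ : ℝ, 0 < κ → ∃ n : ℕ, 1 ≤ n ∧ g (2 * n) < κ * g n := by
    intro κ hκ
    by_contra hall
    push Not at hall
    apply hD
    refine ⟨κ, hκ, fun n hn => ?_⟩
    have h := hall n hn
    unfold g at h
    push_cast at h
    exact h
  -- (1) NS at n = 4, K = {x₀}, ε = 1
  obtain ⟨m, η, δ₀, hm, hη, hδ₀, H⟩ :=
    hNS 4 {x0} (Set.singleton_subset_iff.2 x0_mem) isCompact_singleton 1 one_pos
  -- (2) parameters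
  obtain ⟨p₀, hp₀⟩ := exists_nat_gt (1 / η)
  obtain ⟨N₁, hN₁⟩ := exists_nat_gt (max (1 / δ₀) (1 / η))
  have hp2 : 2 ≤ max p₀ 2 := le_max_right _ _
  have hpη : 1 / η < ((max p₀ 2 : ℕ) : ℝ) := lt_of_lt_of_le hp₀ (by exact_mod_cast le_max_left _ _)
  have hN₀4 : 4 ≤ max N₁ 4 := le_max_right _ _
  have hN₁N₀ : (N₁ : ℝ) ≤ ((max N₁ 4 : ℕ) : ℝ) := by exact_mod_cast le_max_left _ _
  -- abbreviations as plain naturals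
  generalize hp : max p₀ 2 = p at hp2 hpη
  generalize hN₀ : max N₁ 4 = N₀ at hN₀4 hN₁N₀
  -- (3) the defect scale
  have hκpos : 0 < g (2 * N₀) * (1 / 8 : ℝ) ^ p := mul_pos (g_pos _) (by positivity)
  obtain ⟨n, hn1, hlt⟩ := hD' _ hκpos
  have h8le : (1 / 8 : ℝ) ^ p ≤ 1 := pow_le_one₀ (by norm_num) (by norm_num)
  have hκle : g (2 * N₀) * (1 / 8 : ℝ) ^ p ≤ (1 / 8 : ℝ) ^ p := by
    have := g_le_one (2 * N₀)
    have h8 : 0 ≤ (1 / 8 : ℝ) ^ p := by positivity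
    nlinarith
  have hnN₀ : N₀ < n := by
    by_contra hle
    push Not at hle
    have h1 : g (2 * N₀) ≤ g (2 * n) := g_anti (by omega) (by omega)
    have h2 : g (2 * n) < g (2 * N₀) * (1 / 8 : ℝ) ^ p := by
      have := g_le_one n
      have := g_pos n
      have := g_pos (2 * N₀)
      have h8 : 0 ≤ (1 / 8 : ℝ) ^ p := by positivity
      nlinarith
    have h3 : g (2 * N₀) * (1 / 8 : ℝ) ^ p ≤ g (2 * N₀) := by
      have := g_pos (2 * N₀)
      nlinarith
    linarith
  have hn5 : 5 ≤ n := by omega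
  have hnreal : (N₀ : ℝ) < n := by exact_mod_cast hnN₀
  have hN₁n : (N₁ : ℝ) < n := lt_of_le_of_lt hN₁N₀ hnreal
  have hδ₀n : 1 / δ₀ < n := lt_of_le_of_lt (le_max_left _ _) (hN₁.trans hN₁n)
  have hηn : 1 / η < n := lt_of_le_of_lt (le_max_right _ _) (hN₁.trans hN₁n)
  have hnpos : (0 : ℝ) < n := by positivity
  have h2npos : (0 : ℝ) < ((2 * n : ℕ) : ℝ) := by positivity
  -- (4) the mesh is admissible
  have hδlt : mesh n < δ₀ := by
    have h1 : δ₀⁻¹ < ((2 * n : ℕ) : ℝ) := by rw [← one_div]; push_cast; linarith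
    exact (inv_lt_comm₀ h2npos hδ₀).2 h1
  -- (5) the retreat J = q + 1, q = n / p, and the retreated coordinate a = n - J
  obtain ⟨q, hq⟩ : ∃ q : ℕ, q = n / p := ⟨_, rfl⟩
  have hJn : q + 1 + 1 ≤ n := by
    have : q ≤ n / 2 := by rw [hq]; exact Nat.div_le_div_left hp2 (by norm_num)
    omega
  have hpJ : n ≤ p * (q + 1) := by
    have h1 := Nat.div_add_mod n p
    rw [← hq] at h1
    have h2 := Nat.mod_lt n (by omega : 0 < p)
    rw [mul_add, mul_one]
    omega
  -- (6) NS hypotheses at the retreated point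
  have hnorm : ‖yPt n (n - (q + 1)) - x0 1‖ < η := by
    have hsub : yPt n (n - (q + 1)) - x0 1 =
        ((((n - (q + 1) : ℕ) : ℝ) / ((2 * n : ℕ) : ℝ)) - 1 / 2) • e0 := by
      rw [sub_smul]; rfl
    rw [hsub, norm_smul, norm_e0, mul_one, Real.norm_eq_abs]
    have hval : (((n - (q + 1) : ℕ) : ℝ) / ((2 * n : ℕ) : ℝ)) - 1 / 2 =
        -((((q + 1 : ℕ) : ℝ)) / ((2 * n : ℕ) : ℝ)) := by
      rw [Nat.cast_sub (by omega)]
      field_simp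
      push_cast
      ring
    rw [hval, abs_neg, abs_of_nonneg (by positivity)]
    have hJle : ((q : ℕ) : ℝ) + 1 ≤ (n : ℝ) / p + 1 := by
      have : ((q : ℕ) : ℝ) ≤ (n : ℝ) / p := by rw [hq]; exact Nat.cast_div_le
      linarith
    have hp_pos : (0 : ℝ) < p := by
      have : (2 : ℝ) ≤ p := by exact_mod_cast hp2
      linarith
    have h1 : 1 / (p : ℝ) < η := (one_div_lt hp_pos hη).2 hpη
    have h2 : 1 / (n : ℝ) < η := (one_div_lt hnpos hη).2 hηn
    calc ((q + 1 : ℕ) : ℝ) / ((2 * n : ℕ) : ℝ) ≤ ((n : ℝ) / p + 1) / (2 * n) := by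
          push_cast; exact div_le_div_of_nonneg_right hJle (by positivity)
      _ = (1 / p) / 2 + (1 / n) / 2 := by field_simp
      _ < η / 2 + η / 2 := by linarith
      _ = η := by ring
  have hcaged : ¬ (∃ u : EuclideanSpace ℝ (Fin 3), (∃ i j : Fin 3, i ≠ j ∧
      (u = EuclideanSpace.single i 1 ∨ u = EuclideanSpace.single i 1 + EuclideanSpace.single j 1 ∨
        u = EuclideanSpace.single i 1 - EuclideanSpace.single j 1)) ∧
      ((∀ j : Fin 4, j ≠ 1 → inner ℝ u (x0 j) + m ≤ inner ℝ u (x0 1)) ∨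
       (∀ j : Fin 4, j ≠ 1 → inner ℝ u (x0 1) + m ≤ inner ℝ u (x0 j)))) := by
    rintro ⟨u, -, hsep⟩
    exact x0_caged hm u hsep
  -- (7) apply NS and evaluate both sides
  have key := H (mesh n) ⟨mesh_pos hn1, hδlt⟩ x0 rfl 1 (yPt n (n - (q + 1))) hnorm hcaged
  change |rescaledCorrelator (criticalCorr 3) rhoStar 4 (mesh n)
      (Function.update x0 1 (yPt n (n - (q + 1)))) -
    rescaledCorrelator (criticalCorr 3) rhoStar 4 (mesh n) x0| < 1 at key
  have hA := F_update_ge (n := n) (a := n - (q + 1)) hn1 (by omega)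
  have hB := F_x0_le hn1
  have hdiff := (abs_lt.1 key).2
  have h3 : g (n - (q + 1)) / g (2 * n) < 4 * g n / g (2 * n) + 3 := by linarith
  have h4 : g (n - (q + 1)) < 4 * g n + 3 * g (2 * n) := by
    have hg2 := g_pos (2 * n)
    rw [div_lt_iff₀ hg2] at h3
    have : (4 * g n / g (2 * n) + 3) * g (2 * n) = 4 * g n + 3 * g (2 * n) := by field_simp
    linarith
  have h5 : g (2 * n) ≤ g n := g_anti hn1 (by omega)
  -- (8) the pincer's other jaw
  have h6 : 8 * g n ≤ g (n - (q + 1)) :=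
    eight_mul_le_of_ratio_lt hn1 hJn hpJ hκle hlt
  have := g_pos n
  linarith

/-- **NS ⟺ 6150**: with the landed converse (6150 ⟹ 4658 ⟹ 6152) the crux is EXACTLY all-scale
axial doubling of the critical two-point function. -/
theorem nonSeparableModulus_iff_twoPointDoubling :
    MonotoneBlocking.NonSeparableModulus ↔ MirrorHoelderCompactness.TwoPointDoubling :=
  ⟨twoPointDoubling_of_nonSeparableModulus, fun hD =>
    Cruxes.ExistsScaleCovariantLimit.TwoHierarchies.stub_nonSeparableModulus_of_uniformRegularity
      (Cruxes.ExistsScaleCovariantLimit.TwoHierarchies.ItemMaps.uniformRegularity_of_doubling hD)⟩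

/-- The `MirrorHoelderCompactness` copy of the crux (same proposition). -/
theorem mirror_nonSeparableModulus_iff_twoPointDoubling :
    MirrorHoelderCompactness.NonSeparableModulus ↔ MirrorHoelderCompactness.TwoPointDoubling :=
  nonSeparableModulus_iff_twoPointDoubling

end Summit.CriticalPhenomena.Ising3DConformalLimit.Cruxes.NonSeparableModulus.AxialPincer

end
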